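import Literature.NumberTheory.ModularForms.LogLambda
import Literature.NumberTheory.ModularForms.ModerateGrowthTheta
import Mathlib.Analysis.Complex.BorelCaratheodory
import HarnessLib

/-!
# `𝓛` and `𝓛_S` have moderate growth (`𝓛, 𝓛_S ∈ 𝓟`)

Cohn–Kumar–Miller–Radchenko–Viazovska, Ann. of Math. 196 (2022) = arXiv:1902.05438. In §4.2
(Propositions 4.3 and 4.5) the functions `ψ₄ = ξ₄𝓛 + (ξ₄|₄S)𝓛_S`, `ψ₂ = ξ₂𝓛 + (ξ₂|₂S)𝓛_S`,
`ψ̃₀ = 𝓛` span spaces of solutions *in `𝓟`*; the membership of `𝓛 = log λ` and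
`𝓛_S = log(1 − λ)` in Knopp's class `𝓟` (holomorphic of moderate growth, §4.1 (4.1)) is used
implicitly there and in §4.4 ("the coefficient functions … are polynomials in `τ`, `E₂(τ)`, `U(τ)`,
`V(τ)`, `W(τ)`, `𝓛(τ)`, and `𝓛_S(τ)`, and so in particular they lie in `𝓟`"), the paper relying
on the asymptotics (2.10). We PROVE it (`isClassP_logLambdaS`, `isClassP_logLambda`):

1. `−log|Δ(τ)| ≤ C·gauge(τ)³` (`neg_log_norm_discriminant_le`): `|Δ| ≥ |q|/M` on `Im τ ≥ 1/2`
   (`q/Δ = ∏(1 − qⁿ)^{−24}` is continuous, `1`-periodic and bounded at `i∞`), transported to all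
   of `ℍ` by `Δ(γτ) = (cτ + d)¹²Δ(τ)` with `Im(γτ) ≥ 1/2`, `min(1, Im τ) ≤ |cτ + d|`,
   `|cτ + d|² ≤ 2 Im τ`;
2. hence `log|U| ≥ −C·gauge^N` from `256|Δ| = |UVW|²` and `U, V, W ∈ 𝓟`, so that
   `Re 𝓛_S = log|W| − log|U|` is bounded above polynomially in the gauge;
3. `|𝓛_S| ≤ M₁` on `Im τ ≥ 1` (`|𝓛_S|` is `1`-periodic, `𝓛_S → 0` at `i∞`);
4. for `Im τ = y < 1` the Borel–Carathéodory inequality (Mathlib) on the disc of radius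
   `1 − y/2` about `Re τ + i` gives `|𝓛_S(τ)| ≤ 4(M + M₁)/y` with `M` the bound of step 2 on
   the disc;
5. `𝓛 = 𝓛_S|₀S` and `𝓟` is slash-stable (`ModerateGrowth.lean`).

## References

* H. Cohn, A. Kumar, S. D. Miller, D. Radchenko, M. Viazovska, Ann. of Math. 196 (2022),
  arXiv:1902.05438, §2.1.3 (2.10), §4.1 (4.1), §4.2 Props. 4.3/4.5, §4.4. [CohnEtAl2019]
-/

noncomputable section

open Complex hiding I
open Filter Topology ModularForm SlashInvariantForm
open UpperHalfPlane hiding I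
open Complex (I)
open scoped Real MatrixGroups ModularForm Manifold

namespace Literature.NumberTheory.ModularForms

open Literature.NumberTheory.EllipticCurves.JacobiThetaNull

/-! ## Step 1: a lower bound for `|Δ|` -/

/-- `‖q(τ)‖ = e^{−2π Im τ}` for `q = e^{2πiτ}`. [folklore] -/
theorem norm_qParam_one (τ : ℍ) : ‖Function.Periodic.qParam 1 (τ : ℂ)‖ = Real.exp (-2 * π * τ.im) := by
  rw [Function.Periodic.norm_qParam, UpperHalfPlane.coe_im, div_one]

/-- **`|Δ(τ)| ≥ c e^{−2π Im τ}` on `Im τ ≥ 1/2`.** [folklore] -/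
theorem exists_norm_discriminant_ge :
    ∃ c : ℝ, 0 < c ∧ ∀ τ : ℍ, 1 / 2 ≤ τ.im → c * Real.exp (-2 * π * τ.im) ≤ ‖ModularForm.discriminant τ‖ := by
  -- `g = q/Δ = (∏ (1 - qⁿ)^24)⁻¹`
  set g : ℍ → ℂ := fun τ => (∏' n : ℕ, (1 - ModularForm.eta_q n τ) ^ 24)⁻¹ with hg
  have hgq : ∀ τ : ℍ, ModularForm.discriminant τ * g τ = Function.Periodic.qParam 1 (τ : ℂ) := fun τ => by
    have hne : (∏' n : ℕ, (1 - ModularForm.eta_q n (τ : ℂ)) ^ 24) ≠ 0 := by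
      intro h0
      have := ModularForm.discriminant_eq_q_prod τ
      rw [h0, mul_zero] at this
      exact ModularForm.discriminant_ne_zero τ this
    rw [hg]
    simp only
    rw [ModularForm.discriminant_eq_q_prod τ, mul_assoc, mul_inv_cancel₀ hne, mul_one]
  have hgcont : Continuous g := by
    have h1 : Continuous fun τ : ℍ => ModularForm.discriminant τ :=
      (CuspForm.discriminant).holo'.continuous
    have h2 : Continuous fun τ : ℍ => Function.Periodic.qParam 1 (τ : ℂ) := by
      unfold Function.Periodic.qParam; fun_prop
    have : g = fun τ : ℍ => Function.Periodic.qParam 1 (τ : ℂ) / ModularForm.discriminant τ := by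
      funext τ
      rw [eq_div_iff (ModularForm.discriminant_ne_zero τ), mul_comm, hgq]
    rw [this]
    exact h2.div h1 fun τ => ModularForm.discriminant_ne_zero τ
  have hgper : ∀ τ : ℍ, g ((1 : ℝ) +ᵥ τ) = g τ := fun τ => by
    have hΔ : ModularForm.discriminant ((1 : ℝ) +ᵥ τ) = ModularForm.discriminant τ := by
      have := congrFun ModularForm.discriminant_T_invariant τ
      rw [slash_T_apply] at this
      exact this
    have hq : Function.Periodic.qParam 1 (((1 : ℝ) +ᵥ τ : ℍ) : ℂ) = Function.Periodic.qParam 1 (τ : ℂ) := by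
      rw [coe_vadd, ofReal_one]
      simp only [Function.Periodic.qParam]
      rw [show 2 * ↑π * I * (1 + (τ : ℂ)) / (1 : ℝ) = 2 * ↑π * I * (τ : ℂ) / (1 : ℝ) + 2 * π * I by
        push_cast; ring, Complex.exp_add, Complex.exp_two_pi_mul_I, mul_one]
    have h1 := hgq ((1 : ℝ) +ᵥ τ)
    have h2 := hgq τ
    rw [hΔ, hq, ← h2] at h1
    exact mul_left_cancel₀ (ModularForm.discriminant_ne_zero τ) h1
  have hgbdd : IsBoundedAtImInfty g := by
    have ht := ModularForm.tendsto_atImInfty_tprod_one_sub_eta_q_pow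
    have : Tendsto g atImInfty (𝓝 1) := by simpa [hg] using ht.inv₀ one_ne_zero
    exact this.isBigO_one ℝ
  obtain ⟨M, hM⟩ := exists_bound_of_periodic hgcont hgper hgbdd one_half_pos
  have hM0 : 0 < max M 1 := lt_max_of_lt_right one_pos
  refine ⟨(max M 1)⁻¹, inv_pos.2 hM0, fun τ hτ => ?_⟩
  have hq := congrArg (‖·‖) (hgq τ)
  simp only [norm_mul, norm_qParam_one] at hq
  have hgle : ‖g τ‖ ≤ max M 1 := (hM τ hτ).trans (le_max_left _ _)
  rw [inv_mul_le_iff₀ hM0, ← hq]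
  calc ‖ModularForm.discriminant τ‖ * ‖g τ‖ ≤ ‖ModularForm.discriminant τ‖ * max M 1 :=
        mul_le_mul_of_nonneg_left hgle (norm_nonneg _)
    _ = max M 1 * ‖ModularForm.discriminant τ‖ := mul_comm _ _

/-- `|cτ + d|² ≤ 2 Im τ` when `Im(γτ) ≥ 1/2`. [folklore] -/
theorem normSq_denom_le_of_im_smul_ge (γ : SL(2, ℤ)) (τ : ℍ) (h : 1 / 2 ≤ (γ • τ).im) :
    ‖denom (γ : GL (Fin 2) ℝ) τ‖ ^ 2 ≤ 2 * τ.im := by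
  rw [ModularGroup.im_smul_eq_div_normSq, le_div_iff₀ (normSq_pos.2 (denom_ne_zero _ _))] at h
  rw [← Complex.normSq_eq_norm_sq]
  linarith

/-- **`−log|Δ(τ)| ≤ C·gauge(τ)³`** on all of `ℍ`. [folklore] -/
theorem exists_neg_log_norm_discriminant_le :
    ∃ C : ℝ, ∀ τ : ℍ, -Real.log ‖ModularForm.discriminant τ‖ ≤ C * growthGauge τ ^ 3 := by
  obtain ⟨c, hc, hΔ⟩ := exists_norm_discriminant_ge
  refine ⟨|Real.log c| + 2 * π + 12 + 6 * |Real.log 2|, fun τ => ?_⟩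
  obtain ⟨γ, hγ⟩ := ModularGroup.exists_one_half_le_im_smul τ
  have hy : 0 < τ.im := τ.im_pos
  set d : ℂ := denom (γ : GL (Fin 2) ℝ) τ with hd
  have hd0 : d ≠ 0 := denom_ne_zero _ _
  have hdpos : 0 < ‖d‖ := norm_pos_iff.2 hd0
  -- `Δ(γτ) = d¹² Δ(τ)`
  have heq : ModularForm.discriminant (γ • τ) = d ^ (12 : ℤ) * ModularForm.discriminant τ := by
    have hΓ1 : SlashInvariantFormClass (CuspForm 𝒮ℒ 12) (CongruenceSubgroup.Gamma 1) 12 :=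
      CongruenceSubgroup.Gamma_one_coe_eq_SL ▸ (inferInstance : SlashInvariantFormClass (CuspForm 𝒮ℒ 12) 𝒮ℒ 12)
    have := slash_action_eqn_SL'' CuspForm.discriminant (CongruenceSubgroup.mem_Gamma_one γ) τ
    simpa using this
  -- norms
  have h1 : c * Real.exp (-2 * π * (γ • τ).im) ≤ ‖d‖ ^ 12 * ‖ModularForm.discriminant τ‖ := by
    have := hΔ (γ • τ) hγ
    rwa [heq, norm_mul, norm_zpow, zpow_ofNat] at this
  have hΔpos : 0 < ‖ModularForm.discriminant τ‖ := norm_pos_iff.2 (ModularForm.discriminant_ne_zero τ)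
  -- take logs: `log c − 2π Im(γτ) ≤ 12 log‖d‖ + log‖Δ τ‖`
  have h2 : Real.log c + -2 * π * (γ • τ).im ≤ 12 * Real.log ‖d‖ + Real.log ‖ModularForm.discriminant τ‖ := by
    have := Real.log_le_log (mul_pos hc (Real.exp_pos _)) h1
    rwa [Real.log_mul hc.ne' (Real.exp_pos _).ne', Real.log_exp, Real.log_mul (pow_pos hdpos 12).ne'
      hΔpos.ne', Real.log_pow] at this
  -- bounds on `Im(γτ)` and `log ‖d‖`
  have hmin : 0 < min 1 τ.im := lt_min one_pos hy
  have hdge : min 1 τ.im ≤ ‖d‖ := min_one_im_le_norm_denom γ τ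
  have him : (γ • τ).im ≤ τ.im * (min 1 τ.im)⁻¹ ^ 2 := by
    rw [ModularGroup.im_smul_eq_div_normSq, Complex.normSq_eq_norm_sq, div_eq_mul_inv, ← inv_pow]
    exact mul_le_mul_of_nonneg_left (pow_le_pow_left₀ (inv_nonneg.2 (norm_nonneg _))
      (inv_anti₀ hmin hdge) 2) hy.le
  have hG1 := one_le_growthGauge τ
  have hG : τ.im * (min 1 τ.im)⁻¹ ^ 2 ≤ growthGauge τ ^ 3 := by
    have a1 : τ.im ≤ growthGauge τ := (im_le_norm_coe τ).trans (norm_coe_le_growthGauge τ)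
    have a2 : (min 1 τ.im)⁻¹ ≤ growthGauge τ := inv_min_one_im_le_growthGauge τ
    have a20 : 0 ≤ (min 1 τ.im)⁻¹ := inv_nonneg.2 hmin.le
    calc τ.im * (min 1 τ.im)⁻¹ ^ 2 ≤ growthGauge τ * growthGauge τ ^ 2 :=
          mul_le_mul a1 (pow_le_pow_left₀ a20 a2 2) (by positivity) (by positivity)
      _ = growthGauge τ ^ 3 := by ring
  have hlogd : Real.log ‖d‖ ≤ |Real.log 2| / 2 + τ.im := by
    have hsq := normSq_denom_le_of_im_smul_ge γ τ hγ
    have : Real.log (‖d‖ ^ 2) ≤ Real.log (2 * τ.im) := Real.log_le_log (by positivity) hsq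
    rw [Real.log_pow, Real.log_mul two_ne_zero hy.ne'] at this
    have hl : Real.log τ.im ≤ τ.im := Real.log_le_self hy.le
    push_cast at this
    linarith [le_abs_self (Real.log 2)]
  have hyG : τ.im ≤ growthGauge τ := (im_le_norm_coe τ).trans (norm_coe_le_growthGauge τ)
  have hG3 : growthGauge τ ≤ growthGauge τ ^ 3 := le_self_pow₀ hG1 (by norm_num)
  -- assemble
  have key : -Real.log ‖ModularForm.discriminant τ‖ ≤
      -Real.log c + 2 * π * growthGauge τ ^ 3 + 12 * (|Real.log 2| / 2 + growthGauge τ ^ 3) := by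
    nlinarith [h2, him, hG, hlogd, hyG, hG3, Real.pi_pos]
  have hG3' : 1 ≤ growthGauge τ ^ 3 := one_le_pow₀ hG1
  have e1 : -Real.log c ≤ |Real.log c| * growthGauge τ ^ 3 :=
    (neg_le_abs _).trans (le_mul_of_one_le_right (abs_nonneg _) hG3')
  have e2 : 6 * |Real.log 2| ≤ 6 * |Real.log 2| * growthGauge τ ^ 3 :=
    le_mul_of_one_le_right (by positivity) hG3'
  calc -Real.log ‖ModularForm.discriminant τ‖
      ≤ -Real.log c + 2 * π * growthGauge τ ^ 3 + 12 * (|Real.log 2| / 2 + growthGauge τ ^ 3) := key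
    _ ≤ |Real.log c| * growthGauge τ ^ 3 + 2 * π * growthGauge τ ^ 3 +
        (6 * |Real.log 2| * growthGauge τ ^ 3 + 12 * growthGauge τ ^ 3) := by linarith
    _ = (|Real.log c| + 2 * π + 12 + 6 * |Real.log 2|) * growthGauge τ ^ 3 := by ring

/-! ## Step 2: `log|U|` is bounded below polynomially -/

/-- `log x ≤ C·gauge^N` whenever `x ≤ C·gauge^N`-type bounds: `log ‖F τ‖ ≤ ‖F τ‖`. [folklore] -/
theorem log_norm_le_of_hasModerateGrowth {F : ℍ → ℂ} (hF : HasModerateGrowth F) :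
    ∃ (C : ℝ) (N : ℕ), 0 ≤ C ∧ ∀ τ : ℍ, Real.log ‖F τ‖ ≤ C * growthGauge τ ^ N := by
  obtain ⟨C, N, hC, h⟩ := hF.exists_bound
  exact ⟨C, N, hC, fun τ => (Real.log_le_self (norm_nonneg _)).trans (h τ)⟩

/-- **`log|U(τ)| ≥ −C·gauge(τ)^N`** (from `256Δ = (UVW)²`, `−log|Δ| ≤ C gauge³` and
`V, W ∈ 𝓟`). [folklore] -/
theorem exists_log_norm_thetaU_ge :
    ∃ (C : ℝ) (N : ℕ), ∀ τ : ℍ, -(C * growthGauge τ ^ N) ≤ Real.log ‖thetaU τ‖ := by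
  obtain ⟨CΔ, hΔ⟩ := exists_neg_log_norm_discriminant_le
  obtain ⟨CV, NV, hCV, hV⟩ := log_norm_le_of_hasModerateGrowth isClassP_thetaV.2
  obtain ⟨CW, NW, hCW, hW⟩ := log_norm_le_of_hasModerateGrowth isClassP_thetaW.2
  refine ⟨|CΔ| + CV + CW, max 3 (max NV NW), fun τ => ?_⟩
  set G := growthGauge τ with hGdef
  have hG1 : 1 ≤ G := one_le_growthGauge τ
  have hU0 : 0 < ‖thetaU τ‖ := norm_pos_iff.2 (thetaU_ne_zero τ)
  have hV0 : 0 < ‖thetaV τ‖ := norm_pos_iff.2 (thetaV_ne_zero τ)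
  have hW0 : 0 < ‖thetaW τ‖ := norm_pos_iff.2 (thetaW_ne_zero τ)
  -- `log ‖Δ‖ = 2 log‖U‖ + 2 log‖V‖ + 2 log‖W‖ − log 256`
  have hlogΔ : Real.log ‖ModularForm.discriminant τ‖ =
      2 * Real.log ‖thetaU τ‖ + 2 * Real.log ‖thetaV τ‖ + 2 * Real.log ‖thetaW τ‖ - Real.log 256 := by
    rw [discriminant_eq_theta, norm_div, norm_pow, norm_mul, norm_mul, Real.log_div (by positivity)
      (by norm_num), Real.log_pow, Real.log_mul (by positivity) hW0.ne', Real.log_mul hU0.ne' hV0.ne']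
    simp only [RCLike.norm_ofNat]
    push_cast
    ring
  have h256 : 0 ≤ Real.log 256 := Real.log_nonneg (by norm_num)
  have e0 : -Real.log ‖ModularForm.discriminant τ‖ ≤ |CΔ| * G ^ max 3 (max NV NW) := by
    refine (hΔ τ).trans ?_
    exact (mul_le_mul_of_nonneg_right (le_abs_self CΔ) (by positivity)).trans
      (mul_le_mul_of_nonneg_left (pow_le_pow_right₀ hG1 (le_max_left _ _)) (abs_nonneg _))
  have eV : Real.log ‖thetaV τ‖ ≤ CV * G ^ max 3 (max NV NW) :=
    (hV τ).trans (mul_le_mul_of_nonneg_left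
      (pow_le_pow_right₀ hG1 ((le_max_left _ _).trans (le_max_right _ _))) hCV)
  have eW : Real.log ‖thetaW τ‖ ≤ CW * G ^ max 3 (max NV NW) :=
    (hW τ).trans (mul_le_mul_of_nonneg_left
      (pow_le_pow_right₀ hG1 ((le_max_right _ _).trans (le_max_right _ _))) hCW)
  nlinarith [hlogΔ, e0, eV, eW, h256, pow_nonneg (zero_le_one.trans hG1) (max 3 (max NV NW)),
    abs_nonneg CΔ]

/-- **`Re 𝓛_S = log|1 − λ| = log|W| − log|U|` is bounded above polynomially.** [folklore] -/
theorem exists_re_logLambdaS_le :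
    ∃ (C : ℝ) (N : ℕ), 0 ≤ C ∧ ∀ τ : ℍ, (logLambdaS τ).re ≤ C * growthGauge τ ^ N := by
  obtain ⟨CU, NU, hU⟩ := exists_log_norm_thetaU_ge
  obtain ⟨CW, NW, hCW, hW⟩ := log_norm_le_of_hasModerateGrowth isClassP_thetaW.2
  refine ⟨|CU| + CW, max NU NW, by positivity, fun τ => ?_⟩
  have hG1 : 1 ≤ growthGauge τ := one_le_growthGauge τ
  have hU0 : 0 < ‖thetaU τ‖ := norm_pos_iff.2 (thetaU_ne_zero τ)
  have hW0 : 0 < ‖thetaW τ‖ := norm_pos_iff.2 (thetaW_ne_zero τ)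
  have hre : (logLambdaS τ).re = Real.log ‖thetaW τ‖ - Real.log ‖thetaU τ‖ := by
    have h := congrArg (fun z => Real.log ‖z‖) (cexp_logLambdaS τ)
    simp only [Complex.norm_exp, Real.log_exp] at h
    rw [h, one_sub_modularLambda, norm_div, Real.log_div hW0.ne' hU0.ne']
  rw [hre]
  have e1 : Real.log ‖thetaW τ‖ ≤ CW * growthGauge τ ^ max NU NW :=
    (hW τ).trans (mul_le_mul_of_nonneg_left (pow_le_pow_right₀ hG1 (le_max_right _ _)) hCW)
  have e2 : -(|CU| * growthGauge τ ^ max NU NW) ≤ Real.log ‖thetaU τ‖ := by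
    refine le_trans ?_ (hU τ)
    rw [neg_le_neg_iff]
    exact (mul_le_mul_of_nonneg_right (le_abs_self CU) (by positivity)).trans
      (mul_le_mul_of_nonneg_left (pow_le_pow_right₀ hG1 (le_max_left _ _)) (abs_nonneg _))
  linarith

/-! ## Step 3: `|𝓛_S|` is bounded on `Im τ ≥ 1` -/

/-- `‖𝓛_S‖ ≤ M₁` on `Im τ ≥ 1` (`‖𝓛_S‖` is `1`-periodic and `𝓛_S → 0` at `i∞`). [folklore] -/
theorem exists_norm_logLambdaS_le_of_one_le_im :
    ∃ M₁ : ℝ, 0 ≤ M₁ ∧ ∀ τ : ℍ, 1 ≤ τ.im → ‖logLambdaS τ‖ ≤ M₁ := by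
  have hcont : Continuous fun τ : ℍ => ((‖logLambdaS τ‖ : ℝ) : ℂ) :=
    Complex.continuous_ofReal.comp continuous_logLambdaS.norm
  have hper : ∀ τ : ℍ, ((‖logLambdaS ((1 : ℝ) +ᵥ τ)‖ : ℝ) : ℂ) = ((‖logLambdaS τ‖ : ℝ) : ℂ) := fun τ => by
    rw [logLambdaS_vadd_one, norm_neg]
  have hbdd : IsBoundedAtImInfty fun τ : ℍ => ((‖logLambdaS τ‖ : ℝ) : ℂ) := by
    have : Tendsto (fun τ : ℍ => ((‖logLambdaS τ‖ : ℝ) : ℂ)) atImInfty (𝓝 0) := by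
      have h0 := tendsto_logLambdaS_atImInfty.norm
      rw [norm_zero] at h0
      have h := (Complex.continuous_ofReal.tendsto 0).comp h0
      rw [Complex.ofReal_zero] at h
      exact h
    exact this.isBigO_one ℝ
  obtain ⟨M, hM⟩ := exists_bound_of_periodic hcont hper hbdd one_pos
  refine ⟨max M 0, le_max_right _ _, fun τ hτ => ?_⟩
  have := hM τ hτ
  rw [Complex.norm_real, Real.norm_eq_abs, abs_norm] at this
  exact this.trans (le_max_left _ _)

/-! ## Step 4: Borel–Carathéodory below height `1` -/

/-- The gauge on the disc of radius `1 − y/2` about `Re τ + i` is at most `6·gauge(τ)`: if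
`Im σ ≥ Im τ / 2`, `Im τ ≤ 1` and `‖σ‖ ≤ ‖τ‖ + 2` then `gauge σ ≤ 6 gauge τ`. [folklore] -/
theorem growthGauge_le_of_disc {τ σ : ℍ} (h1 : τ.im / 2 ≤ σ.im) (h3 : ‖(σ : ℂ)‖ ≤ ‖(τ : ℂ)‖ + 2) :
    growthGauge σ ≤ 6 * growthGauge τ := by
  unfold growthGauge
  have hy : 0 < τ.im := τ.im_pos
  have hyσ : 0 < σ.im := σ.im_pos
  have ha : max σ.im⁻¹ 1 ≤ 2 * max τ.im⁻¹ 1 := by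
    refine max_le ?_ (by linarith [le_max_right τ.im⁻¹ 1])
    calc σ.im⁻¹ ≤ (τ.im / 2)⁻¹ := inv_anti₀ (by positivity) h1
      _ = 2 * τ.im⁻¹ := by rw [inv_div]; ring
      _ ≤ 2 * max τ.im⁻¹ 1 := by linarith [le_max_left τ.im⁻¹ 1]
  have hb : max ‖(σ : ℂ)‖ 1 ≤ 3 * max ‖(τ : ℂ)‖ 1 := by
    refine max_le ?_ (by linarith [le_max_right ‖(τ : ℂ)‖ 1])
    linarith [le_max_left ‖(τ : ℂ)‖ 1, le_max_right ‖(τ : ℂ)‖ 1]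
  calc max σ.im⁻¹ 1 * max ‖(σ : ℂ)‖ 1 ≤ (2 * max τ.im⁻¹ 1) * (3 * max ‖(τ : ℂ)‖ 1) :=
        mul_le_mul ha hb (zero_le_one.trans (le_max_right _ _)) (by positivity)
    _ = 6 * (max τ.im⁻¹ 1 * max ‖(τ : ℂ)‖ 1) := by ring

/-- **`𝓛_S` has moderate growth.** For `Im τ ≥ 1` this is Step 3; for `Im τ = y < 1` apply the
Borel–Carathéodory inequality to `w ↦ 𝓛_S(Re τ + i + w)` on the disc `‖w‖ < 1 − y/2` at the
point `w = i(y − 1)`, using the upper bound of Step 2 for `Re 𝓛_S` on the disc.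
[cite: CohnEtAl2019, §4.4] -/
theorem hasModerateGrowth_logLambdaS : HasModerateGrowth logLambdaS := by
  obtain ⟨C, N, hC, hre⟩ := exists_re_logLambdaS_le
  obtain ⟨M₁, hM₁, hhigh⟩ := exists_norm_logLambdaS_le_of_one_le_im
  -- the differentiability of `𝓛_S ∘ ofComplex` on the upper half-plane
  have hdiff : DifferentiableOn ℂ (logLambdaS ∘ ofComplex) {z : ℂ | 0 < z.im} :=
    UpperHalfPlane.mdifferentiable_iff.mp mdifferentiable_logLambdaS
  refine hasModerateGrowth_of_le (4 * ((C + 1) * 6 ^ N + M₁) + M₁) (N + 1) fun τ => ?_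
  have hG1 : 1 ≤ growthGauge τ := one_le_growthGauge τ
  have hGN : 1 ≤ growthGauge τ ^ (N + 1) := one_le_pow₀ hG1
  rcases le_or_gt 1 τ.im with hτ1 | hτ1
  · -- high points
    calc ‖logLambdaS τ‖ ≤ M₁ := hhigh τ hτ1
      _ ≤ (4 * ((C + 1) * 6 ^ N + M₁) + M₁) * growthGauge τ ^ (N + 1) := by
          have : 0 ≤ 4 * ((C + 1) * 6 ^ N + M₁) := by positivity
          nlinarith
  · -- low points: Borel–Carathéodory
    set y : ℝ := τ.im with hy
    have hy0 : 0 < y := τ.im_pos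
    set c : ℂ := (τ.re : ℂ) + I with hc
    set R : ℝ := 1 - y / 2 with hR
    have hR0 : 0 < R := by rw [hR]; linarith
    set M : ℝ := (C + 1) * (6 * growthGauge τ) ^ N with hM
    have hM0 : 0 < M := by positivity
    set f : ℂ → ℂ := fun w => logLambdaS (ofComplex (c + w)) with hf
    -- points of the disc lie in `ℍ` with `Im > y/2`
    have him : ∀ w : ℂ, ‖w‖ < R → y / 2 < (c + w).im := fun w hw => by
      have : |w.im| ≤ ‖w‖ := abs_im_le_norm w
      rw [hc, add_im, add_im, ofReal_im, Complex.I_im]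
      rw [hR] at hw
      linarith [neg_abs_le w.im]
    have hpos : ∀ w : ℂ, ‖w‖ < R → 0 < (c + w).im := fun w hw => by linarith [him w hw]
    -- differentiability on the disc
    have hfd : DifferentiableOn ℂ f (Metric.ball 0 R) := by
      refine hdiff.comp ((differentiable_id.const_add c).differentiableOn) fun w hw => ?_
      exact hpos w (by simpa using hw)
    -- the real-part bound on the disc
    have hmaps : Set.MapsTo f (Metric.ball 0 R) {z : ℂ | z.re ≤ M} := by
      intro w hw
      have hw' : ‖w‖ < R := by simpa using hw
      set σ : ℍ := ⟨c + w, hpos w hw'⟩ with hσ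
      have hfw : f w = logLambdaS σ := by
        simp only [f]
        rw [ofComplex_apply_of_im_pos (hpos w hw')]
      rw [Set.mem_setOf_eq, hfw]
      refine (hre σ).trans ?_
      have hGσ : growthGauge σ ≤ 6 * growthGauge τ := by
        refine growthGauge_le_of_disc (le_of_lt ?_) ?_
        · show τ.im / 2 < UpperHalfPlane.im σ
          exact him w hw'
        · show ‖c + w‖ ≤ ‖(τ : ℂ)‖ + 2
          have h1 : ‖c‖ ≤ ‖(τ : ℂ)‖ + 1 := by
            rw [hc]
            refine (norm_add_le _ _).trans ?_
            rw [Complex.norm_real, Complex.norm_I, Real.norm_eq_abs]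
            have : |τ.re| ≤ ‖(τ : ℂ)‖ := by rw [← UpperHalfPlane.coe_re]; exact abs_re_le_norm _
            linarith
          have h2 : ‖w‖ ≤ 1 := by rw [hR] at hw'; linarith
          linarith [norm_add_le c w]
      calc C * growthGauge σ ^ N ≤ C * (6 * growthGauge τ) ^ N :=
            mul_le_mul_of_nonneg_left (pow_le_pow_left₀ (growthGauge_pos σ).le hGσ N) hC
        _ ≤ (C + 1) * (6 * growthGauge τ) ^ N := by
            have : 0 ≤ (6 * growthGauge τ) ^ N := by positivity
            nlinarith
    -- the point `w₀ = i(y - 1)` with `c + w₀ = τ`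
    set w₀ : ℂ := (τ : ℂ) - c with hw₀
    have hw₀n : ‖w₀‖ = 1 - y := by
      have : w₀ = ((y - 1 : ℝ) : ℂ) * I := by
        rw [hw₀, hc]
        apply Complex.ext <;> simp [hy]
      rw [this, norm_mul, Complex.norm_I, mul_one, Complex.norm_real, Real.norm_eq_abs, abs_sub_comm,
        abs_of_pos (by linarith)]
    have hw₀R : w₀ ∈ Metric.ball (0 : ℂ) R := by
      rw [Metric.mem_ball, dist_zero_right, hw₀n, hR]; linarith
    have hBC := Complex.borelCaratheodory hM0 hfd hmaps hR0 hw₀R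
    have hfw₀ : f w₀ = logLambdaS τ := by
      simp only [f, hw₀, add_sub_cancel, ofComplex_apply]
    have hf0 : ‖f 0‖ ≤ M₁ := by
      simp only [f, add_zero]
      have hc1 : 0 < c.im := by simp [hc]
      rw [ofComplex_apply_of_im_pos hc1]
      exact hhigh _ (by show (1 : ℝ) ≤ c.im; simp [hc])
    rw [hfw₀, hw₀n] at hBC
    have hden : R - (1 - y) = y / 2 := by rw [hR]; ring
    have hnum : R + (1 - y) ≤ 2 := by rw [hR]; linarith
    rw [hden] at hBC
    -- `‖𝓛_S τ‖ ≤ 4M/y + 4 M₁/y`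
    have hyinv : y⁻¹ ≤ growthGauge τ := inv_im_le_growthGauge τ
    have key : ‖logLambdaS τ‖ ≤ (4 * M + 4 * M₁) * y⁻¹ := by
      have hy2 : 0 < y / 2 := by positivity
      have t1 : 2 * M * (1 - y) / (y / 2) ≤ 4 * M * y⁻¹ := by
        rw [div_le_iff₀ hy2, show 4 * M * y⁻¹ * (y / 2) = 2 * M by field_simp; ring]
        nlinarith [hM0]
      have t2 : ‖f 0‖ * (R + (1 - y)) / (y / 2) ≤ 4 * M₁ * y⁻¹ := by
        rw [div_le_iff₀ hy2, show 4 * M₁ * y⁻¹ * (y / 2) = 2 * M₁ by field_simp; ring]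
        calc ‖f 0‖ * (R + (1 - y)) ≤ M₁ * 2 := mul_le_mul hf0 hnum (by linarith) hM₁
          _ = 2 * M₁ := by ring
      calc ‖logLambdaS τ‖ ≤ 2 * M * (1 - y) / (y / 2) + ‖f 0‖ * (R + (1 - y)) / (y / 2) := hBC
        _ ≤ 4 * M * y⁻¹ + 4 * M₁ * y⁻¹ := add_le_add t1 t2
        _ = (4 * M + 4 * M₁) * y⁻¹ := by ring
    -- compare with the gauge
    have hM' : M ≤ (C + 1) * 6 ^ N * growthGauge τ ^ N := by rw [hM, mul_pow, mul_assoc]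
    calc ‖logLambdaS τ‖ ≤ (4 * M + 4 * M₁) * y⁻¹ := key
      _ ≤ (4 * ((C + 1) * 6 ^ N * growthGauge τ ^ N) + 4 * M₁ * growthGauge τ ^ N) * growthGauge τ := by
          refine mul_le_mul ?_ hyinv (inv_nonneg.2 hy0.le) (by positivity)
          nlinarith [hM', one_le_pow₀ (n := N) hG1, hM₁]
      _ = 4 * ((C + 1) * 6 ^ N + M₁) * growthGauge τ ^ (N + 1) := by ring
      _ ≤ (4 * ((C + 1) * 6 ^ N + M₁) + M₁) * growthGauge τ ^ (N + 1) := by nlinarith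

/-! ## Step 5: conclusions -/

/-- **`𝓛_S ∈ 𝓟`.** [cite: CohnEtAl2019, §4.4] -/
theorem isClassP_logLambdaS : IsClassP logLambdaS :=
  ⟨mdifferentiable_logLambdaS, hasModerateGrowth_logLambdaS⟩

/-- **`𝓛 ∈ 𝓟`** (`𝓛 = 𝓛_S|₀S` and `𝓟` is slash-stable). [cite: CohnEtAl2019, §4.4] -/
theorem isClassP_logLambda : IsClassP logLambda := by
  rw [← logLambdaS_slash_S]
  exact isClassP_logLambdaS.slash 0 ModularGroup.S

end Literature.NumberTheory.ModularForms
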